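import Literature.NumberTheory.EllipticCurves.CuspFormLFunction
import HarnessLib

/-!
# Discharges of named facts in `CuspFormLFunction.lean` (trunk EllArithM, item C7)

D-0014 keeps `Literature/` sorry-free by stating cited results as named facts `def X : Prop`.
This sibling file proves facts of `Literature.NumberTheory.EllipticCurves.CuspFormLFunction` as
`theorem X_holds : X` (users holding `(h : X)` are fed `X_holds`): two that follow from the
definitions alone, and Hecke's analytic continuation of `L(f, s)` with Rankin's abscissa.

* `IsNewformOf.entireLFunction_eq_holds`: on `re s > 3/2`, `W.entireLFunction s = L(f, s)` for the
  newform `f` of `W`. Both sides equal `W.LSeries s`: the left by construction of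
  `WeierstrassCurve.entireLFunction` (in either branch of its `dite` it agrees with `W.LSeries` on
  `re s > 3/2` — the junk branch *is* `W.LSeries`), the right by `IsNewformOf.cuspFormLSeries_eq`
  (`aₙ(f) = aₙ(W)`, which is the hypothesis `IsNewformOf W f`; Breuil–Conrad–Diamond–Taylor 2001,
  Thm. A supplies such an `f`, it is not needed for the identity).
* `IsNewformOf.completedCuspFormL_eq_completedLFunction_holds`: on `re s > 2` the raw products
  `Λ_N(f, s) = N^{s/2} (2π)^{-s} Γ(s) L(f, s)` and `Λ(W, s) = N^{s/2} (2π)^{-s} Γ(s) L_entire(W, s)`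
  agree factor by factor.
* `exists_differentiable_eq_cuspFormLSeries_holds` (**Hecke's analytic continuation**,
  Hecke 1936; Diamond–Shurman Thm. 5.10.2) and `cuspFormLSeries_eq_mellin_holds` (the Mellin
  formula, Diamond–Shurman Prop. 5.10.1), proved in the generality of a cusp form `f` of any
  weight `k` on an arithmetic subgroup `Γ` with `Γ.strictWidthInfty = 1`
  (`exists_differentiable_eq_cuspFormLSeries_of_strictWidthInfty_eq_one`). Architecture of the
  proof (Hecke's, minus the functional equation): `t ↦ f(it)` decays exponentially at `∞`
  (Mathlib `CuspFormClass.exp_decay_atImInfty'`) and at `0` (apply the same lemma to the cusp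
  form `f ∣[k] S` on `S⁻¹ Γ S`, Mathlib `CuspForm.translate`, and use
  `f(i/y) = (iy)^k (f ∣[k] S)(iy)`), so its Mellin transform `Λ(s) = ∫₀^∞ f(it) t^{s-1} dt` is
  entire (Mathlib `mellin_differentiableAt_of_isBigO_rpow_exp`); termwise integration of the
  `q`-expansion (Mathlib `hasSum_mellin`) gives `Λ(s) = (2π)^{-s} Γ(s) L(f, s)` for
  `re s > max (k/2 + 1) 0`, so `L(s) := (2π)^s Γ(s)⁻¹ Λ(s)` is an entire function equal to
  `L(f, s)` there, and on all of `re s > k/2 + 1` by the identity theorem (`eq_LSeries_of_lt_re`).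
* `LSeriesSummable_cuspCoeff_of_lt_re` (**Rankin's mean-square bound**, Rankin 1977,
  Thm. 4.5.2 (iii)–(iv)): `L(f, s)` converges absolutely already for `re s > (k + 1)/2`, via
  Parseval `∑ |aₙ|² e^{-4πnt} = ∫₀¹ |f(x + it)|² dx ≤ C² t^{-k}` (Mathlib
  `hasSum_sq_fourierCoeffOn`, `CuspFormClass.exists_bound`), the dyadic block bound
  `∑_{2^j ≤ n < 2^{j+1}} |aₙ|² ≤ e^{8π} C² 2^{jk}` and the AM–GM inequality; hence
  (`exists_differentiable_eq_cuspFormLSeries_of_lt_re`) the entire continuation agrees with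
  `L(f, s)` on `re s > (k + 1)/2` — for weight `2` this is the half-plane `re s > 3/2` used by
  `WeierstrassCurve.HasEntireLFunction`.

## References

* C. Breuil, B. Conrad, F. Diamond, R. Taylor, *On the modularity of elliptic curves over `ℚ`:
  wild 3-adic exercises*, J. Amer. Math. Soc. 14 (2001), 843–939, Thm. A.
* F. Diamond, J. Shurman, *A first course in modular forms*, GTM 228, 2005, Prop. 5.9.1, Prop. 5.10.1,
  Thm. 5.10.2.
* E. Hecke, *Über die Bestimmung Dirichletscher Reihen durch ihre Funktionalgleichung*,
  Math. Ann. 112 (1936), 664–699.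
* R. A. Rankin, *Modular forms and functions*, Cambridge Univ. Press, 1977, Thm. 4.5.1, 4.5.2.
-/

noncomputable section

open scoped MatrixGroups ModularForm Manifold

open CongruenceSubgroup UpperHalfPlane Complex Filter Topology Asymptotics Set MeasureTheory

namespace Literature.NumberTheory.EllipticCurves.ModularForms

variable {N : ℕ} [NeZero N]

/-- Discharge of `IsNewformOf.entireLFunction_eq`: if `f ∈ S_2(Γ₀(N))` is the newform of `W`, then
`W.entireLFunction s = L(f, s)` for `re s > 3/2`. Both sides equal `W.LSeries s` there: the left by
construction of `WeierstrassCurve.entireLFunction`, the right because `aₙ(f) = aₙ(W)`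
(Breuil–Conrad–Diamond–Taylor 2001, Thm. A; Diamond–Shurman Thm. 8.8.1). [cite: BreuilConradDiamondTaylor2001, Thm. A] -/
theorem IsNewformOf.entireLFunction_eq_holds : (IsNewformOf.entireLFunction_eq (N := N)) := by
  intro W _ f h s hs
  rw [h.cuspFormLSeries_eq]
  unfold WeierstrassCurve.entireLFunction
  split_ifs with h'
  · exact h'.some_mem.2 s hs
  · rfl

/-- Discharge of `IsNewformOf.completedCuspFormL_eq_completedLFunction`: if `f ∈ S_2(Γ₀(N))` is
the newform of `W`, then for `re s > 2` the raw completed `L`-functions agree,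
`Λ_N(f, s) = N^{s/2} (2π)^{-s} Γ(s) L(f, s) = N^{s/2} (2π)^{-s} Γ(s) L_entire(W, s) = Λ(W, s)`,
since `L_entire(W, s) = L(f, s)` there (`IsNewformOf.entireLFunction_eq_holds`)
(Breuil–Conrad–Diamond–Taylor 2001, Thm. A; Diamond–Shurman §5.10). [cite: BreuilConradDiamondTaylor2001, Thm. A] -/
theorem IsNewformOf.completedCuspFormL_eq_completedLFunction_holds :
    (IsNewformOf.completedCuspFormL_eq_completedLFunction (N := N)) := by
  intro W _ f h s hs
  unfold completedCuspFormL WeierstrassCurve.completedLFunction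
  rw [IsNewformOf.entireLFunction_eq_holds h (by linarith)]

/-! ### Hecke's analytic continuation of `L(f, s)` (discharge of
`exists_differentiable_eq_cuspFormLSeries` and `cuspFormLSeries_eq_mellin`)

Throughout, `𝕀[f]` is local notation for the restriction `t ↦ f(it)` of `f : ℍ → ℂ` to the
positive imaginary axis (extended by Mathlib's junk value of `UpperHalfPlane.ofComplex` for
`t ≤ 0`; only `t > 0` matters under `mellin`). -/

section HeckeContinuation

-- `𝕀[f] t = f(it)`: restriction of `f : ℍ → ℂ` to the imaginary axis (local notation, not a declaration).
local notation "𝕀[" f "]" => fun t : ℝ ↦ (f : ℍ → ℂ) (UpperHalfPlane.ofComplex (Complex.I * (t : ℂ)))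

variable {Γ : Subgroup (GL (Fin 2) ℝ)} {k : ℤ}

/-- **Identity-theorem extension for Dirichlet series.** If `L` is entire, the `L`-series
`∑ aₙ n⁻ˢ` converges absolutely for `re s > x`, and `L(s) = ∑ aₙ n⁻ˢ` on some smaller right
half-plane `re s > y`, then `L(s) = ∑ aₙ n⁻ˢ` on all of `re s > x`: both sides are holomorphic on
the connected open half-plane `re s > x` (Mathlib `LSeries_analyticOnNhd`) and agree near
`y + 1`. [folklore] -/
theorem eq_LSeries_of_lt_re {a : ℕ → ℂ} {L : ℂ → ℂ} {x y : ℝ} (hL : Differentiable ℂ L)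
    (ha : ∀ z : ℝ, x < z → LSeriesSummable a z)
    (heq : ∀ s : ℂ, y < s.re → L s = LSeries a s) {s : ℂ} (hs : x < s.re) :
    L s = LSeries a s := by
  have habs : LSeries.abscissaOfAbsConv a ≤ x :=
    LSeries.abscissaOfAbsConv_le_of_forall_lt_LSeriesSummable
      (fun z hz ↦ by exact_mod_cast ha z hz)
  let U : Set ℂ := {s | x < s.re}
  have hUopen : IsOpen U := isOpen_lt continuous_const Complex.continuous_re
  have hLU : AnalyticOnNhd ℂ L U := hL.differentiableOn.analyticOnNhd hUopen
  have hSU : AnalyticOnNhd ℂ (LSeries a) U := by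
    refine (LSeries_analyticOnNhd a).mono fun z hz ↦ ?_
    exact lt_of_le_of_lt habs (by exact_mod_cast hz)
  have hpre : IsPreconnected U := (convex_halfSpace_re_gt x).isPreconnected
  have hz₀ : ((max x y + 1 : ℝ) : ℂ) ∈ U := by
    show x < ((max x y + 1 : ℝ) : ℂ).re
    rw [Complex.ofReal_re]
    linarith [le_max_left x y]
  have hev : L =ᶠ[𝓝 ((max x y + 1 : ℝ) : ℂ)] LSeries a := by
    have hVopen : IsOpen {s : ℂ | y < s.re} := isOpen_lt continuous_const Complex.continuous_re
    filter_upwards [hVopen.mem_nhds (show y < ((max x y + 1 : ℝ) : ℂ).re by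
      rw [Complex.ofReal_re]; linarith [le_max_right x y])] with z hz
    exact heq z hz
  exact hLU.eqOn_of_preconnected_of_eventuallyEq hSU hpre hz₀ hev hs

/-- For `t > 0`, `𝕀[f] t` is `f` at the genuine point `it ∈ ℍ`. [folklore] -/
lemma imagAxis_apply_of_pos (f : ℍ → ℂ) {t : ℝ} (ht : 0 < t) :
    𝕀[f] t = f ⟨Complex.I * t, by simpa using ht⟩ := by
  dsimp only
  congr 1
  exact ofComplex_apply_of_im_pos (by simpa using ht)

/-- `t ↦ f(it)` is continuous on `(0, ∞)` for holomorphic `f : ℍ → ℂ`. [folklore] -/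
lemma continuousOn_imagAxis {f : ℍ → ℂ} (hf : MDifferentiable 𝓘(ℂ) 𝓘(ℂ) f) :
    ContinuousOn 𝕀[f] (Ioi 0) := by
  have h1 : ContinuousOn (f ∘ ofComplex) {z : ℂ | 0 < z.im} :=
    (UpperHalfPlane.mdifferentiable_iff.mp hf).continuousOn
  have h2 : ContinuousOn (fun t : ℝ ↦ Complex.I * t) (Ioi 0) := by fun_prop
  exact h1.comp h2 fun t ht ↦ by simpa using ht

/-- `it → i∞` in `ℍ` as `t → +∞`. [folklore] -/
lemma tendsto_ofComplex_I_mul_atImInfty :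
    Tendsto (fun t : ℝ ↦ ofComplex (Complex.I * t)) atTop atImInfty := by
  rw [atImInfty, tendsto_comap_iff]
  refine tendsto_id.congr' ?_
  filter_upwards [eventually_gt_atTop 0] with t ht
  simp [Function.comp, ofComplex_apply_of_im_pos (show 0 < (Complex.I * t).im by simpa using ht)]

/-- Transfer of exponential decay at the cusp `∞` to the imaginary axis: if
`g(τ) = O(e^{-c im τ})` as `im τ → ∞` then `g(it) = O(e^{-ct})` as `t → ∞`. [folklore] -/
lemma isBigO_imagAxis_of_isBigO_atImInfty {g : ℍ → ℂ} {c : ℝ}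
    (hg : g =O[atImInfty] fun τ ↦ Real.exp (-c * τ.im)) :
    𝕀[g] =O[atTop] fun t ↦ Real.exp (-c * t) := by
  refine (hg.comp_tendsto tendsto_ofComplex_I_mul_atImInfty).congr' EventuallyEq.rfl ?_
  filter_upwards [eventually_gt_atTop 0] with t ht
  simp [Function.comp, ofComplex_apply_of_im_pos (show 0 < (Complex.I * t).im by simpa using ht),
    UpperHalfPlane.im]

/-- The inversion `S : τ ↦ -1/τ` on the imaginary axis: `f(i/y) = (iy)^k (f ∣[k] S)(iy)` for
`y > 0` (Mathlib `SlashInvariantForm.slash_S_apply`; Diamond–Shurman §5.10, proof of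
Thm. 5.10.2 with `S` in place of `W_N`). [folklore] -/
lemma imagAxis_inv (f : ℍ → ℂ) (k : ℤ) {y : ℝ} (hy : 0 < y) :
    𝕀[f] y⁻¹ = (Complex.I * y) ^ k * 𝕀[f ∣[k] ModularGroup.S] y := by
  rw [imagAxis_apply_of_pos _ (inv_pos.mpr hy), imagAxis_apply_of_pos _ hy,
    SlashInvariantForm.slash_S_apply]
  have hIy : (Complex.I * y : ℂ) ≠ 0 := mul_ne_zero I_ne_zero (ofReal_ne_zero.mpr hy.ne')
  have h1 : (⟨Complex.I * (y⁻¹ : ℝ), by simpa using inv_pos.mpr hy⟩ : ℍ) =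
      UpperHalfPlane.mk (-((⟨Complex.I * y, by simpa using hy⟩ : ℍ) : ℂ))⁻¹
        ((⟨Complex.I * y, by simpa using hy⟩ : ℍ).im_inv_neg_coe_pos) := by
    ext1
    simp only [ofReal_inv]
    field_simp
    simp
    ring
  rw [h1, zpow_neg, mul_left_comm, mul_inv_cancel₀ (zpow_ne_zero k hIy), mul_one]

variable [Γ.IsArithmetic]

/-- A cusp form on an arithmetic subgroup decays exponentially up the imaginary axis:
`f(it) = O(e^{-ct})` as `t → ∞` for some `c > 0` (Mathlib `CuspFormClass.exp_decay_atImInfty'`;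
Diamond–Shurman §5.10; Rankin 1977, Thm. 4.5.1). [folklore] -/
lemma exists_isBigO_imagAxis_atTop (f : CuspForm Γ k) :
    ∃ c : ℝ, 0 < c ∧ 𝕀[f] =O[atTop] fun t ↦ Real.exp (-c * t) := by
  obtain ⟨c, hc, hf⟩ := CuspFormClass.exp_decay_atImInfty' f
  exact ⟨c, hc, isBigO_imagAxis_of_isBigO_atImInfty hf⟩

open ConjAct Pointwise in
/-- The transform `f ∣[k] S` of a cusp form on the arithmetic subgroup `Γ` is a cusp form on the
arithmetic subgroup `S⁻¹ Γ S` (Mathlib `CuspForm.translate`, `Subgroup.IsArithmetic.conj`),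
hence also decays exponentially up the imaginary axis (Diamond–Shurman §5.10; Rankin 1977,
Thm. 4.5.1 "similar estimates hold for the transformed functions `f_L`"). [folklore] -/
lemma exists_isBigO_slash_S_imagAxis_atTop (f : CuspForm Γ k) :
    ∃ c : ℝ, 0 < c ∧ 𝕀[⇑f ∣[k] ModularGroup.S] =O[atTop] fun t ↦ Real.exp (-c * t) := by
  have : ((toConjAct (ModularGroup.S : GL (Fin 2) ℝ)⁻¹) • Γ).IsArithmetic := by
    simpa [(show Rat.castHom ℝ = algebraMap ℚ ℝ by rfl), map_inv,
      Matrix.SpecialLinearGroup.map_mapGL]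
      using! Subgroup.IsArithmetic.conj Γ (Matrix.SpecialLinearGroup.mapGL ℚ ModularGroup.S)⁻¹
  obtain ⟨c, hc, hf⟩ := CuspFormClass.exp_decay_atImInfty' (CuspForm.translate f ModularGroup.S)
  refine ⟨c, hc, ?_⟩
  rw [CuspForm.coe_translate] at hf
  exact isBigO_imagAxis_of_isBigO_atImInfty hf

/-- Rapid decay of a cusp form *down* the imaginary axis, in inverted form: `f(i/y) = O(y^e)`
as `y → ∞` for every real `e` (from `f(i/y) = (iy)^k (f ∣[k] S)(iy)` and the exponential decay
of `f ∣[k] S`; Diamond–Shurman §5.10). [folklore] -/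
lemma isBigO_imagAxis_inv_atTop (f : CuspForm Γ k) (e : ℝ) :
    (fun y : ℝ ↦ 𝕀[f] y⁻¹) =O[atTop] fun y ↦ y ^ e := by
  obtain ⟨c, hc, hS⟩ := exists_isBigO_slash_S_imagAxis_atTop f
  have h1 : (fun y : ℝ ↦ 𝕀[f] y⁻¹) =ᶠ[atTop]
      fun y ↦ (Complex.I * y) ^ k * 𝕀[⇑f ∣[k] ModularGroup.S] y := by
    filter_upwards [eventually_gt_atTop 0] with y hy
    exact imagAxis_inv _ _ hy
  refine h1.trans_isBigO ?_
  have h2 : (fun y : ℝ ↦ (Complex.I * y) ^ k) =O[atTop] fun y ↦ y ^ (k : ℝ) := by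
    refine IsBigO.of_bound 1 ?_
    filter_upwards [eventually_gt_atTop 0] with y hy
    rw [norm_zpow, norm_mul, norm_I, one_mul, norm_real, Real.norm_of_nonneg hy.le, one_mul,
      Real.norm_of_nonneg (Real.rpow_nonneg hy.le _), Real.rpow_intCast]
  have h3 : 𝕀[⇑f ∣[k] ModularGroup.S] =O[atTop] fun y ↦ y ^ (e - k) :=
    hS.trans (isLittleO_exp_neg_mul_rpow_atTop hc _).isBigO
  refine (h2.mul h3).congr' EventuallyEq.rfl ?_
  filter_upwards [eventually_gt_atTop 0] with y hy
  rw [← Real.rpow_add hy]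
  ring_nf

/-- Rapid decay of a cusp form down the imaginary axis: `f(it) = O(t^{-b})` as `t → 0⁺` for
every real `b` (Diamond–Shurman §5.10). [folklore] -/
lemma isBigO_imagAxis_nhdsGT_zero (f : CuspForm Γ k) (b : ℝ) :
    𝕀[f] =O[𝓝[>] 0] (· ^ (-b)) := by
  have h := (isBigO_imagAxis_inv_atTop f b).comp_tendsto tendsto_inv_nhdsGT_zero
  refine h.congr' ?_ ?_
  · filter_upwards with u
    simp [Function.comp]
  · filter_upwards [self_mem_nhdsWithin] with u (hu : 0 < u)
    simp [Function.comp, Real.inv_rpow hu.le, Real.rpow_neg hu.le]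

/-- **The Mellin transform `Λ(s) = ∫₀^∞ f(it) t^{s-1} dt` of a cusp form is entire** (Hecke
1936; Diamond–Shurman Thm. 5.10.2, first assertion): `f(it)` is continuous on `(0, ∞)` and
decays exponentially at both ends, so Mathlib's `mellin_differentiableAt_of_isBigO_rpow_exp`
applies at every `s`. [cite: DiamondShurman2005, Thm. 5.10.2] -/
theorem differentiable_mellin_imagAxis (f : CuspForm Γ k) :
    Differentiable ℂ (mellin 𝕀[f]) := by
  intro s
  obtain ⟨c, hc, htop⟩ := exists_isBigO_imagAxis_atTop f
  exact mellin_differentiableAt_of_isBigO_rpow_exp hc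
    ((continuousOn_imagAxis (CuspFormClass.holo f)).locallyIntegrableOn measurableSet_Ioi) htop
    (isBigO_imagAxis_nhdsGT_zero f (s.re - 1)) (by linarith)

omit [Γ.IsArithmetic] in
/-- The `q`-expansion along the imaginary axis: `f(it) = ∑ aₙ e^{-2πnt}` for `t > 0`, when
`1` is a strict period of `Γ` (Mathlib `UpperHalfPlane.hasSum_qExpansion`; Diamond–Shurman
§5.10). [folklore] -/
lemma hasSum_imagAxis (hΓ : (1 : ℝ) ∈ Γ.strictPeriods) (f : CuspForm Γ k) {t : ℝ} (ht : 0 < t) :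
    HasSum (fun n : ℕ ↦ cuspCoeff f n * (Real.exp (-(2 * Real.pi * n) * t) : ℝ))
      (𝕀[f] t) := by
  haveI : Fact (IsCusp OnePoint.infty Γ) := ⟨Γ.isCusp_of_mem_strictPeriods one_pos hΓ⟩
  have h := UpperHalfPlane.hasSum_qExpansion one_pos
    (SlashInvariantFormClass.periodic_comp_ofComplex f hΓ) (ModularFormClass.holo f)
    (ModularFormClass.bdd_at_infty f) ⟨Complex.I * t, by simpa using ht⟩
  rw [imagAxis_apply_of_pos _ ht]
  convert h using 2 with n
  rw [cuspCoeff, smul_eq_mul]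
  congr 1
  rw [Function.Periodic.qParam, UpperHalfPlane.coe_mk, ← Complex.exp_nat_mul,
    Complex.ofReal_exp]
  congr 1
  push_cast
  rw [div_one, show (n : ℂ) * (2 * Real.pi * Complex.I * (Complex.I * t)) =
    (Complex.I * Complex.I) * (2 * Real.pi * n * t) by ring, I_mul_I]
  ring

omit [Γ.IsArithmetic] in
/-- `a₀(f) = 0` for a cusp form (Mathlib `CuspFormClass.qExpansion_coeff_zero`). [folklore] -/
lemma cuspCoeff_zero (hΓ : (1 : ℝ) ∈ Γ.strictPeriods) (f : CuspForm Γ k) : cuspCoeff f 0 = 0 :=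
  CuspFormClass.qExpansion_coeff_zero f one_pos hΓ

/-- **Mellin transform = completed Dirichlet series** on `re s > max (k/2 + 1) 0`:
`∫₀^∞ f(it) t^{s-1} dt = (2π)^{-s} Γ(s) L(f, s)`, by termwise integration of
`f(it) = ∑ aₙ e^{-2πnt}` (Mathlib `hasSum_mellin`), justified by the absolute convergence of
`L(f, s)` (`LSeriesSummable_cuspCoeff`, Hecke's bound) (Hecke 1936; Diamond–Shurman
Prop. 5.10.1). [cite: DiamondShurman2005, Prop. 5.10.1] -/
theorem mellin_imagAxis_eq (hΓ : Γ.strictWidthInfty = 1) (f : CuspForm Γ k) {s : ℂ}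
    (hs : (k : ℝ) / 2 + 1 < s.re) (hs₀ : 0 < s.re) :
    mellin 𝕀[f] s = (2 * Real.pi : ℂ) ^ (-s) * Complex.Gamma s * cuspFormLSeries f s := by
  have h1 : (1 : ℝ) ∈ Γ.strictPeriods := hΓ ▸ Γ.strictWidthInfty_mem_strictPeriods
  have h0 : cuspCoeff f 0 = 0 := cuspCoeff_zero h1 f
  have hls : LSeriesSummable (cuspCoeff f) s := LSeriesSummable_cuspCoeff hΓ f hs
  -- apply the abstract Mellin lemma
  have hp : ∀ n : ℕ, cuspCoeff f n = 0 ∨ 0 < 2 * Real.pi * n := by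
    intro n
    rcases Nat.eq_zero_or_pos n with rfl | hn
    · exact Or.inl h0
    · exact Or.inr (by positivity)
  have hF : ∀ t ∈ Ioi (0 : ℝ), HasSum (fun n : ℕ ↦ cuspCoeff f n *
      (Real.exp (-(2 * Real.pi * n) * t) : ℝ)) (𝕀[f] t) :=
    fun t ht ↦ hasSum_imagAxis h1 f ht
  have h_sum : Summable fun n : ℕ ↦ ‖cuspCoeff f n‖ / (2 * Real.pi * n) ^ s.re := by
    have := (hls.norm.mul_left ((2 * Real.pi) ^ (-s.re)))
    refine this.congr fun n ↦ ?_
    rw [LSeries.norm_term_eq]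
    rcases Nat.eq_zero_or_pos n with rfl | hn
    · simp [h0]
    · rw [if_neg hn.ne', Real.mul_rpow (x := 2 * Real.pi) (y := (n : ℝ)) (by positivity)
        (by positivity), Real.rpow_neg (by positivity : (0 : ℝ) ≤ 2 * Real.pi)]
      have : 0 < (2 * Real.pi) ^ s.re := by positivity
      field_simp
  have hM := hasSum_mellin hp hs₀ hF h_sum
  -- compare with the `L`-series
  have hL : HasSum (fun n : ℕ ↦ (2 * Real.pi : ℂ) ^ (-s) * Complex.Gamma s *
      LSeries.term (cuspCoeff f) s n)
      ((2 * Real.pi : ℂ) ^ (-s) * Complex.Gamma s * cuspFormLSeries f s) :=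
    hls.hasSum.mul_left _
  refine hM.unique ?_
  convert hL using 2 with n
  rcases Nat.eq_zero_or_pos n with rfl | hn
  · simp [h0, LSeries.term_zero]
  · rw [LSeries.term_of_ne_zero hn.ne', Complex.ofReal_mul,
      Complex.mul_cpow_ofReal_nonneg (by positivity) (by positivity), Complex.ofReal_natCast,
      Complex.cpow_neg]
    have h2π : ((2 * Real.pi : ℝ) : ℂ) ^ s ≠ 0 := by
      rw [Ne, cpow_eq_zero_iff, not_and_or]
      exact Or.inl (by exact_mod_cast Real.two_pi_pos.ne')
    push_cast at h2π ⊢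
    field_simp

/-- **Hecke's `L`-function is entire**: `s ↦ (2π)^s Γ(s)⁻¹ ∫₀^∞ f(it) t^{s-1} dt` is
differentiable on `ℂ` (`1/Γ` is entire, Mathlib `Complex.differentiable_one_div_Gamma`, and
the Mellin transform is entire, `differentiable_mellin_imagAxis`) (Hecke 1936; Diamond–Shurman
Thm. 5.10.2). [cite: DiamondShurman2005, Thm. 5.10.2] -/
theorem differentiable_heckeContinuation (f : CuspForm Γ k) :
    Differentiable ℂ fun s ↦ (2 * Real.pi : ℂ) ^ s * (Complex.Gamma s)⁻¹ * mellin 𝕀[f] s := by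
  intro s
  have h2π : (2 * Real.pi : ℂ) ≠ 0 := by exact_mod_cast Real.two_pi_pos.ne'
  exact ((differentiableAt_id.const_cpow (Or.inl h2π)).mul
    (Complex.differentiable_one_div_Gamma s)).mul (differentiable_mellin_imagAxis f s)

/-- Hecke's entire function `(2π)^s Γ(s)⁻¹ ∫₀^∞ f(it) t^{s-1} dt` equals `L(f, s)` on the whole
half-plane `re s > k/2 + 1` of absolute convergence: on `re s > max (k/2 + 1) 0` by
`mellin_imagAxis_eq` (`Γ(s) ≠ 0` there), and then everywhere by analytic continuation
(`eq_LSeries_of_lt_re`; the extra step only matters for `k < -2`) (Hecke 1936; Diamond–Shurman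
Thm. 5.10.2). [cite: DiamondShurman2005, Thm. 5.10.2] -/
theorem heckeContinuation_eq_cuspFormLSeries (hΓ : Γ.strictWidthInfty = 1) (f : CuspForm Γ k)
    {s : ℂ} (hs : (k : ℝ) / 2 + 1 < s.re) :
    (2 * Real.pi : ℂ) ^ s * (Complex.Gamma s)⁻¹ * mellin 𝕀[f] s = cuspFormLSeries f s := by
  have key : ∀ s : ℂ, max ((k : ℝ) / 2 + 1) 0 < s.re →
      (fun s ↦ (2 * Real.pi : ℂ) ^ s * (Complex.Gamma s)⁻¹ * mellin 𝕀[f] s) s =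
        cuspFormLSeries f s := by
    intro s hs
    have hs₁ : (k : ℝ) / 2 + 1 < s.re := lt_of_le_of_lt (le_max_left _ _) hs
    have hs₀ : 0 < s.re := lt_of_le_of_lt (le_max_right _ _) hs
    dsimp only
    rw [mellin_imagAxis_eq hΓ f hs₁ hs₀]
    have hΓs : Complex.Gamma s ≠ 0 := Complex.Gamma_ne_zero_of_re_pos hs₀
    have h2π : (2 * Real.pi : ℂ) ^ s ≠ 0 := by
      rw [Ne, cpow_eq_zero_iff, not_and_or]
      exact Or.inl (by exact_mod_cast Real.two_pi_pos.ne')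
    rw [cpow_neg]
    field_simp
  exact eq_LSeries_of_lt_re (differentiable_heckeContinuation f)
    (fun z hz ↦ LSeriesSummable_cuspCoeff hΓ f (by simpa using hz)) key hs

/-- **Hecke's analytic continuation** for a cusp form of weight `k` on an arithmetic subgroup
`Γ` whose cusp `∞` has width `1`: `L(f, s)` extends to an entire function, namely
`(2π)^s Γ(s)⁻¹ ∫₀^∞ f(it) t^{s-1} dt` (Hecke 1936; Diamond–Shurman Thm. 5.10.2, "consequently
`L(s, f)` has an analytic continuation to the full `s`-plane", stated there for `Γ₁(N)`).
[cite: DiamondShurman2005, Thm. 5.10.2] -/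
theorem exists_differentiable_eq_cuspFormLSeries_of_strictWidthInfty_eq_one
    (hΓ : Γ.strictWidthInfty = 1) (f : CuspForm Γ k) :
    ∃ L : ℂ → ℂ, Differentiable ℂ L ∧
      ∀ s : ℂ, (k : ℝ) / 2 + 1 < s.re → L s = cuspFormLSeries f s :=
  ⟨_, differentiable_heckeContinuation f, fun _ hs ↦ heckeContinuation_eq_cuspFormLSeries hΓ f hs⟩

omit [Γ.IsArithmetic] in
/-- Discharge of the named fact `exists_differentiable_eq_cuspFormLSeries`: for
`f ∈ S_k(Γ₀(N))`, `L(f, s)` extends to an entire function (Hecke 1936; Diamond–Shurman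
Thm. 5.10.2); the case `Γ = Γ₀(N)` (`strictWidthInfty_Gamma0`) of
`exists_differentiable_eq_cuspFormLSeries_of_strictWidthInfty_eq_one`. [cite: DiamondShurman2005, Thm. 5.10.2] -/
theorem exists_differentiable_eq_cuspFormLSeries_holds :
    exists_differentiable_eq_cuspFormLSeries (k := k) :=
  fun {N} _ f ↦ exists_differentiable_eq_cuspFormLSeries_of_strictWidthInfty_eq_one
    (strictWidthInfty_Gamma0 N) f

omit [Γ.IsArithmetic] in
/-- Discharge of the named fact `cuspFormLSeries_eq_mellin`: for `re s > k/2 + 1`,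
`L(f, s) = (2π)^s / Γ(s) · ∫₀^∞ f(it) t^{s-1} dt` (Hecke 1936; Diamond–Shurman Prop. 5.10.1);
this is `heckeContinuation_eq_cuspFormLSeries` read backwards. [cite: DiamondShurman2005, Prop. 5.10.1] -/
theorem cuspFormLSeries_eq_mellin_holds : cuspFormLSeries_eq_mellin (Γ := Γ) (k := k) := by
  intro _ hΓ f s hs
  rw [← heckeContinuation_eq_cuspFormLSeries hΓ f hs, div_eq_mul_inv]

end HeckeContinuation

/-! ### Rankin's mean-square bound: absolute convergence for `re s > (k + 1)/2` -/

section Rankin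

-- `𝕀[f] t = f(it)`: restriction of `f : ℍ → ℂ` to the imaginary axis (local notation, not a declaration).
local notation "𝕀[" f "]" => fun t : ℝ ↦ (f : ℍ → ℂ) (UpperHalfPlane.ofComplex (Complex.I * (t : ℂ)))

variable {Γ : Subgroup (GL (Fin 2) ℝ)} {k : ℤ}

/-- The Fourier coefficients of the `1`-periodic function `x ↦ f(x + it)` on `[0, 1]` are
`aₙ e^{-2πnt}` (`n ≥ 0`): Mathlib's `ModularFormClass.qExpansion_coeff_eq_intervalIntegral`
(`aₙ = ∫₀¹ f(x + it) e^{-2πin(x + it)} dx`, Diamond–Shurman, proof of Prop. 5.9.1; Rankin 1977,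
proof of Thm. 4.5.2) rewritten in terms of Mathlib's `fourierCoeffOn`. [folklore] -/
lemma fourierCoeffOn_horizontal (hΓ : (1 : ℝ) ∈ Γ.strictPeriods) (f : CuspForm Γ k) {t : ℝ}
    (ht : 0 < t) (n : ℕ) :
    fourierCoeffOn zero_lt_one (fun x : ℝ ↦ f ⟨x + t * Complex.I, by simp [ht]⟩) n =
      cuspCoeff f n * (Real.exp (-(2 * Real.pi * n * t)) : ℝ) := by
  rw [fourierCoeffOn_eq_integral, cuspCoeff,
    ModularFormClass.qExpansion_coeff_eq_intervalIntegral (f := f) one_pos hΓ n ht]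
  simp_rw [fourier_coe_apply]
  simp only [sub_zero, div_one, one_smul, smul_eq_mul, Complex.ofReal_one, one_div,
    one_mul, Int.cast_neg, Int.cast_natCast]
  rw [← intervalIntegral.integral_mul_const]
  refine intervalIntegral.integral_congr fun x _ ↦ ?_
  simp only [Function.Periodic.qParam, Complex.ofReal_exp, div_one, Complex.ofReal_one,
    ← Complex.exp_nat_mul, ← Complex.exp_neg]
  rw [mul_right_comm (cexp _) (f _) (cexp _), ← Complex.exp_add]
  congr 2
  push_cast
  ring_nf
  rw [I_sq]
  ring

/-- **Parseval bound** (Rankin 1977, proof of Thm. 4.5.2 (iii); Diamond–Shurman Ex. 5.9):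
if `|f(τ)| ≤ C (im τ)^{-k/2}` on `ℍ` then for every `t > 0` and every finite set of indices,
`∑ |aₙ|² e^{-4πnt} ≤ ∫₀¹ |f(x + it)|² dx ≤ C² t^{-k}` (Mathlib `hasSum_sq_fourierCoeffOn`).
[cite: Rankin1977, Thm. 4.5.2] -/
lemma sum_sq_cuspCoeff_mul_exp_le (hΓ : (1 : ℝ) ∈ Γ.strictPeriods) (f : CuspForm Γ k) {C : ℝ}
    (hC : ∀ τ : ℍ, ‖f τ‖ ≤ C / τ.im ^ ((k : ℝ) / 2)) {t : ℝ} (ht : 0 < t) (s : Finset ℕ) :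
    ∑ n ∈ s, ‖cuspCoeff f n‖ ^ 2 * Real.exp (-(4 * Real.pi * n * t)) ≤ C ^ 2 / t ^ (k : ℝ) := by
  set F : ℝ → ℂ := fun x : ℝ ↦ f ⟨x + t * Complex.I, by simp [ht]⟩ with hF
  have hFc : Continuous F := by
    apply (ModularFormClass.continuous f).comp
    fun_prop (disch := simp [ht])
  have hFb : ∀ x, ‖F x‖ ≤ C / t ^ ((k : ℝ) / 2) := fun x ↦ by
    simpa [UpperHalfPlane.im] using hC ⟨x + t * Complex.I, by simp [ht]⟩
  have hL2 : MemLp F 2 (volume.restrict (Ioc 0 1)) :=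
    MemLp.of_bound hFc.aestronglyMeasurable _ (ae_of_all _ hFb)
  have hP := hasSum_sq_fourierCoeffOn zero_lt_one hL2
  have hint : ∫ x in (0 : ℝ)..1, ‖F x‖ ^ 2 ≤ (C / t ^ ((k : ℝ) / 2)) ^ 2 := by
    calc ∫ x in (0 : ℝ)..1, ‖F x‖ ^ 2 ≤ ∫ x in (0 : ℝ)..1, (C / t ^ ((k : ℝ) / 2)) ^ 2 :=
          intervalIntegral.integral_mono_on zero_le_one
            ((hFc.norm.pow 2).intervalIntegrable 0 1) (continuous_const.intervalIntegrable 0 1)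
            (fun x _ ↦ pow_le_pow_left₀ (norm_nonneg _) (hFb x) 2)
      _ = (C / t ^ ((k : ℝ) / 2)) ^ 2 := by simp
  have h1 : ∑ n ∈ s, ‖cuspCoeff f n‖ ^ 2 * Real.exp (-(4 * Real.pi * n * t)) =
      ∑ i ∈ s.map Nat.castEmbedding, ‖fourierCoeffOn zero_lt_one F i‖ ^ 2 := by
    rw [Finset.sum_map]
    refine Finset.sum_congr rfl fun n _ ↦ ?_
    rw [Nat.castEmbedding_apply, hF, fourierCoeffOn_horizontal hΓ f ht n, norm_mul, mul_pow,
      Complex.norm_real, Real.norm_of_nonneg (Real.exp_pos _).le, ← Real.exp_nat_mul]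
    congr 2
    push_cast
    ring
  calc ∑ n ∈ s, ‖cuspCoeff f n‖ ^ 2 * Real.exp (-(4 * Real.pi * n * t))
      = ∑ i ∈ s.map Nat.castEmbedding, ‖fourierCoeffOn zero_lt_one F i‖ ^ 2 := h1
    _ ≤ (1 - 0 : ℝ)⁻¹ • ∫ x in (0 : ℝ)..1, ‖F x‖ ^ 2 :=
        sum_le_hasSum _ (fun i _ ↦ by positivity) hP
    _ ≤ (C / t ^ ((k : ℝ) / 2)) ^ 2 := by simpa using hint
    _ = C ^ 2 / t ^ (k : ℝ) := by
        rw [div_pow, ← Real.rpow_natCast (t ^ ((k : ℝ) / 2)) 2, ← Real.rpow_mul ht.le]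
        norm_num

/-- **Rankin's dyadic mean-square bound** (Rankin 1977, Thm. 4.5.2 (iii):
`∑_{n ≤ m} |aₙ|² = O(m^k)`), in the block form `∑_{2^j ≤ n < 2^{j+1}} |aₙ|² ≤ e^{8π} C² (2^j)^k`:
take `t = 2^{-j}` in `sum_sq_cuspCoeff_mul_exp_le`, where `e^{-4πnt} ≥ e^{-8π}` on the block.
[cite: Rankin1977, Thm. 4.5.2 (iii)] -/
lemma sum_Ico_sq_cuspCoeff_le (hΓ : (1 : ℝ) ∈ Γ.strictPeriods) (f : CuspForm Γ k) {C : ℝ}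
    (hC : ∀ τ : ℍ, ‖f τ‖ ≤ C / τ.im ^ ((k : ℝ) / 2)) (j : ℕ) :
    ∑ n ∈ Finset.Ico (2 ^ j) (2 ^ (j + 1)), ‖cuspCoeff f n‖ ^ 2 ≤
      Real.exp (8 * Real.pi) * C ^ 2 * ((2 : ℝ) ^ j) ^ (k : ℝ) := by
  have hq : (0 : ℝ) < 2 ^ j := by positivity
  set t : ℝ := ((2 : ℝ) ^ j)⁻¹ with ht_def
  have ht : 0 < t := inv_pos.mpr hq
  have hmain := sum_sq_cuspCoeff_mul_exp_le hΓ f hC ht (Finset.Ico (2 ^ j) (2 ^ (j + 1)))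
  have htk : C ^ 2 / t ^ (k : ℝ) = C ^ 2 * ((2 : ℝ) ^ j) ^ (k : ℝ) := by
    rw [ht_def, Real.inv_rpow hq.le, div_inv_eq_mul]
  rw [htk] at hmain
  calc ∑ n ∈ Finset.Ico (2 ^ j) (2 ^ (j + 1)), ‖cuspCoeff f n‖ ^ 2
      ≤ ∑ n ∈ Finset.Ico (2 ^ j) (2 ^ (j + 1)),
          Real.exp (8 * Real.pi) * (‖cuspCoeff f n‖ ^ 2 * Real.exp (-(4 * Real.pi * n * t))) := by
        refine Finset.sum_le_sum fun n hn ↦ ?_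
        rw [Finset.mem_Ico] at hn
        rw [mul_left_comm, ← Real.exp_add]
        have hnt : (n : ℝ) * t ≤ 2 := by
          rw [ht_def, ← div_eq_mul_inv, div_le_iff₀ hq]
          have : (n : ℝ) ≤ 2 ^ (j + 1) := by exact_mod_cast hn.2.le
          simpa [pow_succ, mul_comm] using this
        have h0 : 0 ≤ 8 * Real.pi + -(4 * Real.pi * n * t) := by
          have := Real.pi_pos
          nlinarith
        calc ‖cuspCoeff f n‖ ^ 2 = ‖cuspCoeff f n‖ ^ 2 * 1 := (mul_one _).symm
          _ ≤ ‖cuspCoeff f n‖ ^ 2 * Real.exp (8 * Real.pi + -(4 * Real.pi * n * t)) := by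
              gcongr
              exact Real.one_le_exp h0
    _ = Real.exp (8 * Real.pi) *
          ∑ n ∈ Finset.Ico (2 ^ j) (2 ^ (j + 1)),
            ‖cuspCoeff f n‖ ^ 2 * Real.exp (-(4 * Real.pi * n * t)) := by
        rw [Finset.mul_sum]
    _ ≤ Real.exp (8 * Real.pi) * (C ^ 2 * ((2 : ℝ) ^ j) ^ (k : ℝ)) := by
        gcongr
    _ = Real.exp (8 * Real.pi) * C ^ 2 * ((2 : ℝ) ^ j) ^ (k : ℝ) := by ring

/-- Elementary: on the dyadic block `2^j ≤ n < 2^{j+1}`, `n^{-e} ≤ 2^{|e|} (2^j)^{-e}` for every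
real `e`. [folklore] -/
lemma rpow_inv_le_of_mem_Ico {e : ℝ} {j n : ℕ} (hn : n ∈ Finset.Ico (2 ^ j) (2 ^ (j + 1))) :
    ((n : ℝ) ^ e)⁻¹ ≤ (2 : ℝ) ^ |e| * (((2 : ℝ) ^ j) ^ e)⁻¹ := by
  rw [Finset.mem_Ico] at hn
  have hq : (0 : ℝ) < 2 ^ j := by positivity
  have hn1 : ((2 : ℝ) ^ j) ≤ n := by exact_mod_cast hn.1
  have hn0 : (0 : ℝ) < n := lt_of_lt_of_le hq hn1
  have hn2 : (n : ℝ) ≤ 2 * 2 ^ j := by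
    have : (n : ℝ) ≤ 2 ^ (j + 1) := by exact_mod_cast hn.2.le
    simpa [pow_succ, mul_comm] using this
  rcases le_or_gt 0 e with he | he
  · rw [abs_of_nonneg he]
    calc ((n : ℝ) ^ e)⁻¹ ≤ (((2 : ℝ) ^ j) ^ e)⁻¹ :=
          inv_anti₀ (Real.rpow_pos_of_pos hq e) (Real.rpow_le_rpow hq.le hn1 he)
      _ = 1 * (((2 : ℝ) ^ j) ^ e)⁻¹ := (one_mul _).symm
      _ ≤ (2 : ℝ) ^ e * (((2 : ℝ) ^ j) ^ e)⁻¹ := by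
          gcongr
          exact Real.one_le_rpow one_le_two he
  · rw [abs_of_neg he]
    have h1 : (2 * (2 : ℝ) ^ j) ^ e ≤ (n : ℝ) ^ e :=
      Real.rpow_le_rpow_of_nonpos hn0 hn2 he.le
    rw [Real.mul_rpow zero_le_two hq.le] at h1
    have h2 : 0 < (2 : ℝ) ^ e * ((2 : ℝ) ^ j) ^ e := by positivity
    calc ((n : ℝ) ^ e)⁻¹ ≤ ((2 : ℝ) ^ e * ((2 : ℝ) ^ j) ^ e)⁻¹ := by
          gcongr
      _ = (2 : ℝ) ^ (-e) * (((2 : ℝ) ^ j) ^ e)⁻¹ := by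
          rw [mul_inv, Real.rpow_neg zero_le_two]

/-- **Dyadic summation lemma** (elementary real analysis): if `bₙ ≥ 0` and the dyadic block sums
satisfy `∑_{2^j ≤ n < 2^{j+1}} bₙ ≤ K (2^j)^κ`, then `∑ bₙ n^{-e}` converges for every `e > κ`
(each block contributes `≤ 2^{|e|} K (2^{κ-e})^j`, a convergent geometric series). This is the
partial-summation step in Rankin 1977, Thm. 4.5.2 (iii) ⇒ (iv). [folklore] -/
theorem summable_div_rpow_of_sum_Ico_le {b : ℕ → ℝ} (hb : ∀ n, 0 ≤ b n) {K κ e : ℝ}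
    (hK : ∀ j : ℕ, ∑ n ∈ Finset.Ico (2 ^ j) (2 ^ (j + 1)), b n ≤ K * ((2 : ℝ) ^ j) ^ κ)
    (he : κ < e) : Summable fun n : ℕ ↦ b n / (n : ℝ) ^ e := by
  set g : ℕ → ℝ := fun n ↦ b n / (n : ℝ) ^ e with hg_def
  have hg : ∀ n, 0 ≤ g n := fun n ↦ div_nonneg (hb n) (Real.rpow_nonneg (Nat.cast_nonneg n) e)
  have hK0 : 0 ≤ K := by
    have := (Finset.sum_nonneg fun n _ ↦ hb n).trans (hK 0)
    simpa using this
  set ρ : ℝ := (2 : ℝ) ^ (κ - e) with hρ_def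
  have hρ0 : 0 ≤ ρ := Real.rpow_nonneg zero_le_two _
  have hρ1 : ρ < 1 := Real.rpow_lt_one_of_one_lt_of_neg one_lt_two (by linarith)
  set M : ℝ := (2 : ℝ) ^ |e| * K with hM_def
  -- block estimate for `g`
  have hblock : ∀ j : ℕ, ∑ n ∈ Finset.Ico (2 ^ j) (2 ^ (j + 1)), g n ≤ M * ρ ^ j := by
    intro j
    have hq : (0 : ℝ) < 2 ^ j := by positivity
    calc ∑ n ∈ Finset.Ico (2 ^ j) (2 ^ (j + 1)), g n
        ≤ ∑ n ∈ Finset.Ico (2 ^ j) (2 ^ (j + 1)),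
            (2 : ℝ) ^ |e| * (((2 : ℝ) ^ j) ^ e)⁻¹ * b n := by
          refine Finset.sum_le_sum fun n hn ↦ ?_
          rw [hg_def]
          dsimp only
          rw [div_eq_mul_inv, mul_comm]
          exact mul_le_mul_of_nonneg_right (rpow_inv_le_of_mem_Ico hn) (hb n)
      _ = (2 : ℝ) ^ |e| * (((2 : ℝ) ^ j) ^ e)⁻¹ *
            ∑ n ∈ Finset.Ico (2 ^ j) (2 ^ (j + 1)), b n := by rw [Finset.mul_sum]
      _ ≤ (2 : ℝ) ^ |e| * (((2 : ℝ) ^ j) ^ e)⁻¹ * (K * ((2 : ℝ) ^ j) ^ κ) := by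
          gcongr
          exact hK j
      _ = M * ρ ^ j := by
          rw [hM_def, hρ_def, ← Real.rpow_natCast ((2 : ℝ) ^ (κ - e)) j,
            ← Real.rpow_mul zero_le_two, mul_comm (κ - e) (j : ℝ), Real.rpow_mul zero_le_two,
            Real.rpow_natCast (2 : ℝ) j, Real.rpow_sub hq, ← Real.rpow_neg hq.le]
          field_simp
          rw [Real.rpow_neg hq.le]
          field_simp
  -- partial sums over `range (2^J)`
  have hdyadic : ∀ J : ℕ, ∑ n ∈ Finset.range (2 ^ J), g n ≤
      g 0 + M * ∑ j ∈ Finset.range J, ρ ^ j := by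
    intro J
    induction J with
    | zero => simp
    | succ J ih =>
      rw [Finset.range_eq_Ico, ← Finset.sum_Ico_consecutive g (Nat.zero_le _)
        (Nat.pow_le_pow_right two_pos (Nat.le_succ J)), ← Finset.range_eq_Ico,
        Finset.sum_range_succ, mul_add]
      linarith [hblock J, ih]
  have hgeom : ∀ J : ℕ, ∑ j ∈ Finset.range J, ρ ^ j ≤ (1 - ρ)⁻¹ := fun J ↦
    sum_le_hasSum _ (fun j _ ↦ pow_nonneg hρ0 j) (hasSum_geometric_of_lt_one hρ0 hρ1)
  refine summable_of_sum_range_le hg (c := g 0 + M * (1 - ρ)⁻¹) fun N ↦ ?_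
  calc ∑ n ∈ Finset.range N, g n ≤ ∑ n ∈ Finset.range (2 ^ N), g n :=
        Finset.sum_le_sum_of_subset_of_nonneg (Finset.range_mono N.lt_two_pow_self.le)
          fun n _ _ ↦ hg n
    _ ≤ g 0 + M * ∑ j ∈ Finset.range N, ρ ^ j := hdyadic N
    _ ≤ g 0 + M * (1 - ρ)⁻¹ := by
        gcongr
        exact hgeom N

/-- **AM–GM step**: if `∑ |aₙ|² n^{-e} < ∞` and `2σ = e + 1 + δ` with `δ > 0`, then
`∑ |aₙ| n^{-σ} < ∞`, since `|aₙ| n^{-σ} = (|aₙ| n^{-e/2}) · n^{-(1+δ)/2} ≤ ½ (|aₙ|² n^{-e} +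
n^{-1-δ})` (the Cauchy–Schwarz step of Rankin 1977, Thm. 4.5.2 (iii) ⇒ (iv), in summable
form). [folklore] -/
lemma summable_norm_div_rpow_of_sq {a : ℕ → ℂ} {e δ σ : ℝ} (hδ : 0 < δ) (hσ : 2 * σ = e + (1 + δ))
    (h : Summable fun n : ℕ ↦ ‖a n‖ ^ 2 / (n : ℝ) ^ e) (h0 : a 0 = 0) :
    Summable fun n : ℕ ↦ ‖a n‖ / (n : ℝ) ^ σ := by
  have h2 : Summable fun n : ℕ ↦ 1 / (n : ℝ) ^ (1 + δ) :=
    Real.summable_one_div_nat_rpow.mpr (by linarith)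
  refine Summable.of_nonneg_of_le (fun n ↦ by positivity)
    (fun n ↦ ?_) (((h.add h2).div_const 2))
  rcases Nat.eq_zero_or_pos n with rfl | hn
  · simp [h0]
    positivity
  · have hn' : (0 : ℝ) < n := by exact_mod_cast hn
    have hx2 : (‖a n‖ / (n : ℝ) ^ (e / 2)) ^ 2 = ‖a n‖ ^ 2 / (n : ℝ) ^ e := by
      rw [div_pow, ← Real.rpow_natCast ((n : ℝ) ^ (e / 2)) 2, ← Real.rpow_mul hn'.le]
      norm_num
    have hy2 : (1 / (n : ℝ) ^ ((1 + δ) / 2)) ^ 2 = 1 / (n : ℝ) ^ (1 + δ) := by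
      rw [div_pow, one_pow, ← Real.rpow_natCast ((n : ℝ) ^ ((1 + δ) / 2)) 2,
        ← Real.rpow_mul hn'.le]
      norm_num
    have hxy : ‖a n‖ / (n : ℝ) ^ σ =
        (‖a n‖ / (n : ℝ) ^ (e / 2)) * (1 / (n : ℝ) ^ ((1 + δ) / 2)) := by
      rw [div_mul_div_comm, mul_one, ← Real.rpow_add hn']
      congr 2
      linarith
    rw [hxy, ← hx2, ← hy2]
    have := two_mul_le_add_sq (‖a n‖ / (n : ℝ) ^ (e / 2)) (1 / (n : ℝ) ^ ((1 + δ) / 2))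
    linarith

variable [Γ.IsArithmetic]

/-- **Absolute convergence of `L(f, s)` for `re s > (k + 1)/2`** (Rankin 1977, Thm. 4.5.2 (iv):
`∑_{n ≤ m} |aₙ| = O(m^{(k+1)/2})`, whence the abscissa of absolute convergence is at most
`(k + 1)/2`; sharper than Hecke's `k/2 + 1` of `LSeriesSummable_cuspCoeff` /
Diamond–Shurman Prop. 5.9.1), for a cusp form of weight `k` on an arithmetic subgroup with cusp
width `1` at `∞`. Proof: `CuspFormClass.exists_bound` (`|f| ≤ C im^{-k/2}`), the dyadic
mean-square bound `sum_Ico_sq_cuspCoeff_le`, `summable_div_rpow_of_sum_Ico_le` with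
`e = re s + (k - 1)/2 > k`, and the AM–GM step `summable_norm_div_rpow_of_sq`.
[cite: Rankin1977, Thm. 4.5.2 (iv)] -/
theorem LSeriesSummable_cuspCoeff_of_lt_re (hΓ : Γ.strictWidthInfty = 1) (f : CuspForm Γ k)
    {s : ℂ} (hs : ((k : ℝ) + 1) / 2 < s.re) : LSeriesSummable (cuspCoeff f) s := by
  have h1 : (1 : ℝ) ∈ Γ.strictPeriods := hΓ ▸ Γ.strictWidthInfty_mem_strictPeriods
  obtain ⟨C, hC⟩ := CuspFormClass.exists_bound f
  have h0 : cuspCoeff f 0 = 0 := CuspFormClass.qExpansion_coeff_zero f one_pos h1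
  -- mean square: `∑ |aₙ|² n^{-e} < ∞` for `e = re s + (k-1)/2 > k`
  have hsq : Summable fun n : ℕ ↦ ‖cuspCoeff f n‖ ^ 2 / (n : ℝ) ^ (s.re + ((k : ℝ) - 1) / 2) :=
    summable_div_rpow_of_sum_Ico_le (fun n ↦ by positivity)
      (sum_Ico_sq_cuspCoeff_le h1 f hC) (by linarith)
  have hsum : Summable fun n : ℕ ↦ ‖cuspCoeff f n‖ / (n : ℝ) ^ s.re :=
    summable_norm_div_rpow_of_sq (δ := s.re - ((k : ℝ) + 1) / 2) (by linarith) (by ring) hsq h0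
  -- compare with the `L`-series terms
  refine Summable.of_norm (hsum.of_nonneg_of_le (fun n ↦ norm_nonneg _) fun n ↦ ?_)
  rw [LSeries.norm_term_eq]
  split_ifs with hn
  · positivity
  · exact le_rfl

/-- Hecke's entire function `(2π)^s Γ(s)⁻¹ ∫₀^∞ f(it) t^{s-1} dt` equals `L(f, s)` on the larger
half-plane `re s > (k + 1)/2` where the series still converges absolutely
(`LSeriesSummable_cuspCoeff_of_lt_re` and the identity theorem `eq_LSeries_of_lt_re`)
(Hecke 1936; Rankin 1977, Thm. 4.5.2 (iv); Diamond–Shurman Thm. 5.10.2). [cite: DiamondShurman2005, Thm. 5.10.2] -/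
theorem heckeContinuation_eq_cuspFormLSeries_of_lt_re (hΓ : Γ.strictWidthInfty = 1)
    (f : CuspForm Γ k) {s : ℂ} (hs : ((k : ℝ) + 1) / 2 < s.re) :
    (2 * Real.pi : ℂ) ^ s * (Complex.Gamma s)⁻¹ * mellin 𝕀[f] s = cuspFormLSeries f s :=
  eq_LSeries_of_lt_re (L := fun s ↦ (2 * Real.pi : ℂ) ^ s * (Complex.Gamma s)⁻¹ * mellin 𝕀[f] s)
    (differentiable_heckeContinuation f)
    (fun z hz ↦ LSeriesSummable_cuspCoeff_of_lt_re hΓ f (by simpa using hz))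
    (fun z hz ↦ heckeContinuation_eq_cuspFormLSeries hΓ f hz) hs

/-- **Hecke + Rankin**: for a cusp form of weight `k` on an arithmetic subgroup with cusp width
`1` at `∞` (e.g. `Γ₀(N)`, `Γ₁(N)`), there is an entire function agreeing with
`L(f, s) = ∑ aₙ n⁻ˢ` on the half-plane `re s > (k + 1)/2` (Hecke 1936; Rankin 1977, Thm. 4.5.2;
Diamond–Shurman Thm. 5.10.2). For `k = 2` the half-plane is `re s > 3/2`. [cite: DiamondShurman2005, Thm. 5.10.2] -/
theorem exists_differentiable_eq_cuspFormLSeries_of_lt_re (hΓ : Γ.strictWidthInfty = 1)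
    (f : CuspForm Γ k) :
    ∃ L : ℂ → ℂ, Differentiable ℂ L ∧
      ∀ s : ℂ, ((k : ℝ) + 1) / 2 < s.re → L s = cuspFormLSeries f s :=
  ⟨_, differentiable_heckeContinuation f,
    fun _ hs ↦ heckeContinuation_eq_cuspFormLSeries_of_lt_re hΓ f hs⟩

end Rankin

end Literature.NumberTheory.EllipticCurves.ModularForms
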